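import Summits.NavierStokesRegularity.NavierStokesRegularity.Theorems.ScenarioCensusRowF1ax
import Summits.NavierStokesRegularity.NavierStokesRegularity.Theorems.TypeICertificateLadderRungZero
import Literature.Analysis.FluidPDE.BarkerPrange2020VorticityAlignmentTypeIHolds
import Literature.Analysis.FluidPDE.TypeIAncientMildTimeAnalytic
import HarnessLib
import Summits.NavierStokesRegularity.NavierStokesRegularity.Theorems.ScenarioCensusRowF1NeedleTopSector

/-!
# Census row F1, criteria read on SIGNED STARS — weighted sums of the velocity along `k` rays out of a fast point, at SNAPSHOTS (cells F1st / F1se / F1od; floor STF) —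
# LINE 38 «star-top» port, part 1/2: §1 objects (frame of LINES 34–37 BY NAME; `CalmStarAt`, the rows `Row_F1st` / `Row_F1se`); §2–§3 compactness, socket and the snapshot
# zoom package (LINE 37's, BY NAME); §4 the SIGNED-STAR KILL and the mass dichotomy (`star_kill`, `eq_zero_of_star`, `star_limit`, `StarDefectBelow`, `exists_starLevel`)

Re-homed for the scenario census (typer seat ns-census-typer-1 g10; the cells F1st / F1se / F1od and the floor STF are MEMBERS OF RECORD «DECIDED IN KERNEL IN FILES» of row F1
(item 81: critic idea-crit-3 PASS no price tier B−, KEY-NS #215; ref PRE-CHECK ✓ §19.2; lead label); this port makes them TREE-decided): VERBATIM PORT of ns-idea-3 LINE 38 «star-top»,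
`pub/ideators/ns-idea-3/lines/star-top/line-star-top.lean` sha16 f51dcbbb884150b4 (850 l., lean check rc 0, 0 sorry), split for the 400-line rule into
`ScenarioCensusRowF1StarTop` (§1–§4) → `…StarTopRows` (§5–§7 + census KEYS).  Lean text VERBATIM in namespace `…Theorems.ScenarioCensus.StarTop` (the line's
`…Cruxes.ScenarioCensusRowF1.StarTopLine` re-homed); port edits: the frame restated VERBATIM by the line from LINES 34–37 (`topSet`, `HasTypeIConstant`, `snapLevel`, `exists_fast_at`,
`limitClass_compact`, `exists_level_of_limitKill`, `exists_snapshotZoom_package`, `zoom_units`, `CalmNeedlesAt`, `Row_F1nd`) is taken BY NAME from the landed two-time-top /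
one-level-top / snapshot-top / needle-top ports; the second proof term `rowF1nd_holds` is not re-declared (route `rowF1nd_of_rowF1st rowF1st_holds`); `@[conjecture]` on the residual
`StarCollapse` (≡ `ScenarioCensus.Row_F1`, OPEN); one-line docstrings added where missing (gate lint).  Statements untouched.

No census VALUE is moved here (row F1 stays OPEN-WITH-LINE; the members become TREE-decided by name); NS regularity is NOT proved; `Row_F1` is untouched (zero
movement, `starCollapse_iff_rowF1`); no summit statement is proved by this file. Lemmas that restate already-landed tree declarations are taken BY NAME (gate lint `dedup.landed`): `topSet` = `TwoTimeTop.topSet`, `HasTypeIConstant` = `OneLevelTop.HasTypeIConstant`, `snapLevel` = `SnapshotTop.snapLevel`, `exists_fast_at` = `SnapshotTop.exists_fast_at`, `sqrt_mul_sq_mul` = `SnapshotTop.sqrt_mul_sq_mul`, `limitClass_compact` = `NeedleTop.limitClass_compact`, `exists_level_of_limitKill` = `NeedleTop.exists_level_of_limitKill`, `exists_snapshotZoom_package` = `NeedleTop.exists_snapshotZoom_package`, `zoom_units` = `NeedleTop.zoom_units`, `CalmNeedlesAt` = `NeedleTop.CalmNeedlesAt`, `Row_F1nd` = `NeedleTo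p.Row_F1nd`.
-/

-- the summit and its single problem share the name `NavierStokesRegularity` (D-0017 nested layout)
set_option linter.dupNamespace false

noncomputable section

open MeasureTheory Set Function Filter TopologicalSpace Metric
open scoped Topology NNReal ENNReal InnerProductSpace

namespace Summit.NavierStokesRegularity.NavierStokesRegularity.Theorems.ScenarioCensus.StarTop

open Literature.Analysis Literature.Analysis.FluidPDE
open Summit.NavierStokesRegularity.NavierStokesRegularity.Theorems
open Summit.NavierStokesRegularity.NavierStokesRegularity.Theses

/-- `ℝ³`. -/
abbrev E3 := EuclideanSpace ℝ (Fin 3)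

/-! ## §1 Objects: top, dimensionless Type-I constant, Leray's snapshot level `c_S`, SIGNED STAR READ-OUTS at ONE instant; the rows -/

-- `topSet`: the line restates the tree's `TwoTimeTop.topSet`; taken BY NAME (gate lint dedup.landed).

-- `HasTypeIConstant`: the line restates the tree's `OneLevelTop.HasTypeIConstant`; taken BY NAME (gate lint dedup.landed).

-- `snapLevel`: the line restates the tree's `SnapshotTop.snapLevel`; taken BY NAME (gate lint dedup.landed).

/-- **A calm SIGNED STAR at ONE instant `t`** (level `Λ`, reach `A`, length `a`, WEIGHTS `c : Fin k → ℝ`, threshold `ε`;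
parabolic unit `ℓ = √(ν(T − t))`, speed unit `√ν/√(T − t)`): every `Λ`-fast point `x` carries `k` unit directions `e i` and ONE
start `r₀ ∈ [0, A]` such that for every `r ∈ [r₀, r₀ + a]` the WEIGHTED SUM of the velocities at the `k` star points `x + r ℓ e i`
has dimensionless size `≤ ε`:  `√(T − t) ‖∑ i, c i • u(t, x + r ℓ e i)‖ ≤ ε √ν`.  NO point is asked to be calm: with `k = 2`,
`c = (1, 1)`, `e₁ = −e₀` it says the velocity is nearly ODD about `x` along `e₀` at parabolic distances `r` (COUNTERFLOW at full
speed allowed, `OddCalmAt`); with `k = 1`, `c = 1` it is LINE 37's calm needle.  The directions may coincide; only the MASS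
`∑ i, c i` of the weights decides whether the read-out carries a kill (§4). -/
def CalmStarAt {k : ℕ} (ν T : ℝ) (u : ℝ → E3 → E3) (Λ A a : ℝ) (c : Fin k → ℝ) (ε t : ℝ) : Prop :=
  ∀ x ∈ TwoTimeTop.topSet ν T u Λ t, ∃ e : Fin k → E3, (∀ i, ‖e i‖ = 1) ∧ ∃ r₀ ∈ Icc (0 : ℝ) A,
    ∀ r ∈ Icc r₀ (r₀ + a),
      Real.sqrt (T - t) * ‖∑ i, c i • u t (x + (r * Real.sqrt (ν * (T - t))) • e i)‖ ≤ ε * Real.sqrt ν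

/-- **ROW F1st «CALM-SIGNED-STAR SNAPSHOTS»** (Type I · no symmetry · Clay class; PROVED, `rowF1st_holds`): for every
dimensionless Type-I constant `M`, reach `A`, length `a > 0`, and every weight vector `c : Fin k → ℝ` of NONZERO MASS
`∑ i, c i ≠ 0`, there is `ε = ε(M, A, a, c) > 0` such that: if along SOME sequence of instants `t_k ↑ T` every `c_S`-fast point
carries an `ε`-calm `c`-weighted star of length `a ℓ` starting within `A ℓ`, the solution extends smoothly past `T`.  For mass
ZERO nothing is claimed (and nothing can be: §5 `calmStarAt_const_of_sum_eq_zero`). -/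
def Row_F1st : Prop :=
  ∀ (M A a : ℝ) (k : ℕ) (c : Fin k → ℝ), 0 < a → ∑ i, c i ≠ 0 → ∃ ε : ℝ, 0 < ε ∧
    ∀ (ν T : ℝ), 0 < ν → 0 < T → ∀ (u : ℝ → E3 → E3) (p : ℝ → E3 → ℝ),
    IsClassicalNSSolutionOn (Ico 0 T) ν 0 u p → IsLerayHopfOn T ν 0 (u 0) u →
    HasRapidSpatialDecay (u 0) → OneLevelTop.HasTypeIConstant ν T M u →
    (∃ᶠ t in 𝓝[<] T, CalmStarAt ν T u SnapshotTop.snapLevel A a c ε t) →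
    HasSmoothExtensionPast ν 0 u T

/-- **ROW F1se «CALM SIGNED STARS, EVENTUALLY»** (the `∀ᶠ`-form; a formal COROLLARY of `Row_F1st`, `rowF1se_of_rowF1st`). -/
def Row_F1se : Prop :=
  ∀ (M A a : ℝ) (k : ℕ) (c : Fin k → ℝ), 0 < a → ∑ i, c i ≠ 0 → ∃ ε : ℝ, 0 < ε ∧
    ∀ (ν T : ℝ), 0 < ν → 0 < T → ∀ (u : ℝ → E3 → E3) (p : ℝ → E3 → ℝ),
    IsClassicalNSSolutionOn (Ico 0 T) ν 0 u p → IsLerayHopfOn T ν 0 (u 0) u →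
    HasRapidSpatialDecay (u 0) → OneLevelTop.HasTypeIConstant ν T M u →
    (∀ᶠ t in 𝓝[<] T, CalmStarAt ν T u SnapshotTop.snapLevel A a c ε t) →
    HasSmoothExtensionPast ν 0 u T

/-- Order: the calm-star snapshot row implies its eventual form. -/
theorem rowF1se_of_rowF1st (h : Row_F1st) : Row_F1se := by
  intro M A a k c ha hc
  obtain ⟨ε, hε, hrow⟩ := h M A a k c ha hc
  exact ⟨ε, hε, fun ν T hν hT u p hsol hLH hdec hM hev => hrow ν T hν hT u p hsol hLH hdec hM hev.frequently⟩

/-! ## §2 COMPACTNESS of `𝒦_M` (values pointwise AND locally uniformly on slices, gradients pointwise) and the SOCKET LEMMA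

`𝒦_M` = `IsTypeIAncientMild M`.  The tree's extraction theorem `exists_tendsto_of_typeI_seq_Ioo` (KNSS 2009, Lemma 6.1) fed with
MEMBERS of `𝒦_M` is the sequential compactness of `𝒦_M`; LINE 36 recorded pointwise values and gradients, LINE 37 (VERBATIM
here) ALSO keeps the extraction theorem's third output — LOCALLY UNIFORM convergence of every slice — because a star read along the
zoom MOVES (its directions `e_j i` and start `r₀_j` depend on `j`) and converges only after a further compactness step on
`(e_j, r₀_j)`; evaluating a locally uniformly convergent sequence along convergent sequences of points
(`TendstoLocallyUniformly.tendsto_comp`) is what reads the calm star on the limit slice. -/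

-- `limitClass_compact`: the line restates the tree's `NeedleTop.limitClass_compact`; taken BY NAME (gate lint dedup.landed).

-- `tendstoLocallyUniformly_comp_of_tendsto`: a statement-twin of the landed `AdaptedFrequencyTangentFlowTransfer.tendstoLocallyUniformly_comp_of_tendsto` (whose module imports a route file and is therefore NOT imported here; gate lint dedup.landed); not re-declared — its 3-line folklore proof (subsequences of locally uniformly convergent sequences) is inlined at the use site.

-- `exists_level_of_limitKill`: the line restates the tree's `NeedleTop.exists_level_of_limitKill`; taken BY NAME (gate lint dedup.landed).

/-! ## §3 MECHANISM, part 1 — Leray's EVERY-TIME floor and the PRESCRIBED-TIME (SNAPSHOT) ZOOM PACKAGE (LINE 37 §3 VERBATIM: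
LINE 36's package with the locally-uniform clause)

Leray's lower rate holds at EVERY instant of `[0, T)` (tree `leray_blowup_rate_top_holds`, with the sub-strip boundedness
`eLpNorm_uncurry_top_lt_top_of_tao2011` exactly as in the tree's proof of `typeICertificateLadder_rungZero`), so zoom centres can be
placed at ANY prescribed instants — in particular inside any set of times hit frequently as `t ↑ T` — at `c_S`-fast points.  The
zoom carries a SNAPSHOT hypothesis at the times `t_k` to the single slice `s = −1` of the limit: values and gradients pointwise
(LINE 36) and values LOCALLY UNIFORMLY (LINE 37; needed to read a star whose directions and start MOVE with `k`). -/

-- `exists_fast_at`: the line restates the tree's `SnapshotTop.exists_fast_at`; taken BY NAME (gate lint dedup.landed).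

-- `sqrt_mul_sq_mul`: the line restates the tree's `SnapshotTop.sqrt_mul_sq_mul`; taken BY NAME (gate lint dedup.landed).

-- `exists_snapshotZoom_package`: the line restates the tree's `NeedleTop.exists_snapshotZoom_package`; taken BY NAME (gate lint dedup.landed).

/-! ## §4 MECHANISM, part 2 — the SIGNED-STAR KILL and the MASS DICHOTOMY

The slice `W(−1, ·)` of a member of `𝒦_M` is real-analytic on `ℝ³` (tree `IsTypeIAncientMild.analyticOnNhd_slice_univ`), so
for unit directions `e i` and weights `c i` the ONE-VARIABLE function `r ↦ ∑ i, c i • W(−1, r e i)` is real-analytic on the whole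
line `ℝ` (finite sum of analytic compositions with the linear rays `r ↦ r e i`).  If it vanishes on an open interval of radii it
vanishes identically (identity theorem on the connected line), in particular at `r = 0`, where ALL `k` rays meet at the
normalisation point: `(∑ i, c i) • W(−1, 0) = 0`.  Hence THE MASS DICHOTOMY: if `∑ i, c i ≠ 0` the star read-out kills
(`W(−1, 0) = 0` against `‖W(−1, 0)‖ ≥ c_S`); if `∑ i, c i = 0` the conclusion is EMPTY (`0 • W(−1,0) = 0`) — and rightly so: a
balanced read-out is blind to the constant mode (§5: a uniform stream, fast everywhere, has calm balanced stars of every shape).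
LINE 37's needle kill is the case `k = 1`; what is new is that for `k ≥ 2` NO POINT of the star needs to be calm. -/

/-- **(KΣ) THE SIGNED-STAR KILL.**  `W ∈ 𝒦_M`, `t < 0`, weights `c`, directions `e` (any vectors): if
`∑ i, c i • W(t, r e i) = 0` for `r` in a non-empty open interval, then `(∑ i, c i) • W(t, 0) = 0`. -/
theorem star_kill {M : ℝ} {W : ℝ → E3 → E3} (hW : IsTypeIAncientMild M W) {t : ℝ} (ht : t < 0)
    {k : ℕ} (c : Fin k → ℝ) (e : Fin k → E3) {r₁ r₂ : ℝ} (hr : r₁ < r₂)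
    (h : ∀ r ∈ Ioo r₁ r₂, ∑ i, c i • W t (r • e i) = 0) : (∑ i, c i) • W t 0 = 0 := by
  have hray : ∀ (i : Fin k) (r : ℝ), AnalyticAt ℝ (fun r : ℝ => r • e i) r := fun i r =>
    (ContinuousLinearMap.toSpanSingleton ℝ (e i)).analyticAt r
  have han₁ : ∀ i : Fin k, AnalyticOnNhd ℝ (fun r : ℝ => c i • W t (r • e i)) univ := by
    intro i r _
    have h2 : AnalyticAt ℝ (W t) (r • e i) := hW.analyticOnNhd_slice_univ ht _ (mem_univ _)
    have h3 : AnalyticAt ℝ (W t ∘ fun r : ℝ => r • e i) r :=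
      AnalyticAt.comp (g := W t) (f := fun r : ℝ => r • e i) (x := r) h2 (hray i r)
    exact h3.fun_const_smul
  have han : AnalyticOnNhd ℝ (fun r : ℝ => ∑ i, c i • W t (r • e i)) univ :=
    Finset.analyticOnNhd_fun_sum Finset.univ fun i _ => han₁ i
  have hmid₁ : r₁ < (r₁ + r₂) / 2 := by linarith
  have hmid₂ : (r₁ + r₂) / 2 < r₂ := by linarith
  have hz : ∀ᶠ r in 𝓝 ((r₁ + r₂) / 2), (∑ i, c i • W t (r • e i)) = 0 := by
    filter_upwards [Ioo_mem_nhds hmid₁ hmid₂] with r hr'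
    exact h r hr'
  have hEq : EqOn (fun r : ℝ => ∑ i, c i • W t (r • e i)) 0 univ :=
    han.eqOn_zero_of_preconnected_of_eventuallyEq_zero isPreconnected_univ (mem_univ ((r₁ + r₂) / 2)) hz
  have h0 := hEq (mem_univ (0 : ℝ))
  simp only [zero_smul, Pi.zero_apply] at h0
  rw [Finset.sum_smul]
  exact h0

/-- **(KΣ₊) A star of NONZERO MASS vanishing on a radial interval forces the centre value to vanish.** -/
theorem eq_zero_of_star {M : ℝ} {W : ℝ → E3 → E3} (hW : IsTypeIAncientMild M W) {t : ℝ} (ht : t < 0)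
    {k : ℕ} {c : Fin k → ℝ} (hc : ∑ i, c i ≠ 0) (e : Fin k → E3) {r₁ r₂ : ℝ} (hr : r₁ < r₂)
    (h : ∀ r ∈ Ioo r₁ r₂, ∑ i, c i • W t (r • e i) = 0) : W t 0 = 0 := by
  have h1 := star_kill hW ht c e hr h
  rcases smul_eq_zero.1 h1 with h2 | h2
  · exact absurd h2 hc
  · exact h2

/-- **(K₀) For mass ZERO the kill is empty**: the conclusion of (KΣ) holds for EVERY field. -/
theorem star_kill_vacuous_of_sum_eq_zero {k : ℕ} {c : Fin k → ℝ} (hc : ∑ i, c i = 0) (W : ℝ → E3 → E3) (t : ℝ) :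
    (∑ i, c i) • W t 0 = 0 := by
  rw [hc, zero_smul]

/-- **Stars pass to locally uniform limits** (compactness of the star parameters `(e_j, r₀_j) ∈ (S²)ᵏ × [0, A]` and evaluation
of a locally uniformly convergent sequence along `k` convergent sequences of points). -/
theorem star_limit {F : Type*} [NormedAddCommGroup F] [NormedSpace ℝ F] {k : ℕ} (c : Fin k → ℝ) {A a : ℝ}
    {f : ℕ → E3 → F} {g : E3 → F} (hfg : TendstoLocallyUniformly f g atTop) (hg : Continuous g)
    {e : ℕ → Fin k → E3} (he : ∀ j i, ‖e j i‖ = 1) {r₀ : ℕ → ℝ} (hr₀ : ∀ j, r₀ j ∈ Icc (0 : ℝ) A)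
    {b : ℕ → ℝ} {b₀ : ℝ} (hb : Tendsto b atTop (𝓝 b₀))
    (hf : ∀ j, ∀ ρ ∈ Icc (0 : ℝ) a, ‖∑ i, c i • f j ((r₀ j + ρ) • e j i)‖ ≤ b j) :
    ∃ e₀ : Fin k → E3, (∀ i, ‖e₀ i‖ = 1) ∧ ∃ ρ₀ ∈ Icc (0 : ℝ) A,
      ∀ ρ ∈ Icc (0 : ℝ) a, ‖∑ i, c i • g ((ρ₀ + ρ) • e₀ i)‖ ≤ b₀ := by
  set D : Set (Fin k → E3) := Set.pi univ fun _ => sphere (0 : E3) 1 with hD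
  have hDc : IsCompact D := isCompact_univ_pi fun _ => isCompact_sphere (0 : E3) 1
  have hK : IsCompact (D ×ˢ Icc (0 : ℝ) A) := hDc.prod isCompact_Icc
  have hmem : ∀ j, (fun j => (e j, r₀ j)) j ∈ D ×ˢ Icc (0 : ℝ) A := fun j =>
    ⟨fun i _ => mem_sphere_zero_iff_norm.2 (he j i), hr₀ j⟩
  obtain ⟨q, hq, ψ, hψ, hlim⟩ := hK.tendsto_subseq hmem
  obtain ⟨he₀, hρ₀⟩ := hq
  refine ⟨q.1, fun i => mem_sphere_zero_iff_norm.1 (he₀ i (mem_univ i)), q.2, hρ₀, fun ρ hρ => ?_⟩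
  have hψt : Tendsto ψ atTop atTop := hψ.tendsto_atTop
  have hlim' := (Prod.tendsto_iff _ _).1 hlim
  have he_lim : Tendsto (fun j => e (ψ j)) atTop (𝓝 q.1) := hlim'.1
  have hr_lim : Tendsto (fun j => r₀ (ψ j)) atTop (𝓝 q.2) := hlim'.2
  have hy : ∀ i : Fin k, Tendsto (fun j => (r₀ (ψ j) + ρ) • e (ψ j) i) atTop (𝓝 ((q.2 + ρ) • q.1 i)) := fun i =>
    (hr_lim.add tendsto_const_nhds).smul (tendsto_pi_nhds.1 he_lim i)
  have hfgψ : TendstoLocallyUniformly (fun j => f (ψ j)) g atTop := fun v hv z => by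
    obtain ⟨t, ht, hev⟩ := hfg v hv z
    exact ⟨t, ht, hψt.eventually hev⟩
  have h1 : Tendsto (fun j => ∑ i, c i • f (ψ j) ((r₀ (ψ j) + ρ) • e (ψ j) i)) atTop
      (𝓝 (∑ i, c i • g ((q.2 + ρ) • q.1 i))) :=
    tendsto_finsetSum Finset.univ fun i _ => (hfgψ.tendsto_comp hg.continuousAt (hy i)).const_smul (c i)
  exact le_of_tendsto_of_tendsto h1.norm (hb.comp hψt) (Eventually.of_forall fun j => hf (ψ j) ρ hρ)

/-- The **star defect below `Λ`** of `W` on the slice `s = −1` (reach `A`, length `a`, weights `c`): unit directions `e i` and a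
start `r₀ ∈ [0, A]` with `‖∑ i, c i • W(−1, (r₀ + ρ) e i)‖ ≤ Λ` for `ρ ∈ [0, a]`. -/
def StarDefectBelow {k : ℕ} (A a : ℝ) (c : Fin k → ℝ) (Λ : ℝ) (W : ℝ → E3 → E3) : Prop :=
  ∃ e : Fin k → E3, (∀ i, ‖e i‖ = 1) ∧ ∃ r₀ ∈ Icc (0 : ℝ) A,
    ∀ ρ ∈ Icc (0 : ℝ) a, ‖∑ i, c i • W (-1) ((r₀ + ρ) • e i)‖ ≤ Λ

/-- **THE CALM-STAR LEVEL `Λ₁(M, A, a, c, κ)`** for weights of NONZERO mass: no `W ∈ 𝒦_M` with `‖W(−1, 0)‖ ≥ κ` has star defect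
below `Λ₁` (socket of §2 + star limit + (KΣ₊)). -/
theorem exists_starLevel (M A a : ℝ) {k : ℕ} (c : Fin k → ℝ) (ha : 0 < a) (hc : ∑ i, c i ≠ 0) {κ : ℝ} (hκ : 0 < κ) :
    ∃ Λ₁ : ℝ, 0 < Λ₁ ∧ ∀ W : ℝ → E3 → E3, IsTypeIAncientMild M W → κ ≤ ‖W (-1) 0‖ →
      ¬ StarDefectBelow A a c Λ₁ W := by
  refine NeedleTop.exists_level_of_limitKill M hκ (StarDefectBelow A a c) ?_
  intro Wn W ε hεpos hεlim hWn hW hP _ _ hlu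
  choose e he r₀ hr₀ hcalm using hP
  have hcont : Continuous (W (-1)) := hW.continuous_slice (by norm_num)
  obtain ⟨e₀, -, ρ₀, -, hlim⟩ := star_limit c (hlu (-1) (by norm_num)) hcont he hr₀ hεlim hcalm
  have hzero : ∀ r ∈ Ioo ρ₀ (ρ₀ + a), ∑ i, c i • W (-1) (r • e₀ i) = 0 := by
    intro r hr
    have h0 : ‖∑ i, c i • W (-1) ((ρ₀ + (r - ρ₀)) • e₀ i)‖ ≤ 0 := hlim (r - ρ₀) ⟨by linarith [hr.1], by linarith [hr.2]⟩
    rw [show ρ₀ + (r - ρ₀) = r by ring] at h0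
    exact norm_le_zero_iff.1 h0
  exact eq_zero_of_star hW (by norm_num) hc e₀ (by linarith) hzero

end Summit.NavierStokesRegularity.NavierStokesRegularity.Theorems.ScenarioCensus.StarTop

end
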